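/-
Copyright (c) 2026 the pub-hodgecm-mathlib formalisation cell (harness21).  Prover seat hodgecm-mathlib-LH7-p06 (g3), req620 Track A «(D-RAM) FOUR-FRAME» squad
((β₂) road (R-36), lane C (RamM) UPPER-LINE RAY PROGRAM of LH7-p10 (g3), G8 ‹HU_RAY_C♮-diag› input «LH7-p06′»: the (hI) digit part at an arbitrary socket radius), 2026-09-05.
-/
import Summits.HodgeConjecture.HodgeConjecture.Theorems.F0P3cDyRamRowCellGeneratorIndependence     -- ★ p864148 (this seat): §1–§4 algebra ∕ sizes ∕ CLASS PART `cls_iff_cls_of_gen` BY NAME; brings ★ p863914, ★ p863477, ★ p863222, ★ p863081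
import HarnessLib

/-!
# Crux `H413`, line LH4 «(D-RAM) FOUR-FRAME» — (β₂) road, K6-(b) ∕ RAY bands of BOTH lanes: «THE (hI) LETTER AT AN ARBITRARY RADIUS» — ★ p864148's digit part and HEAD with
# the radius letter `|jEϖ|^b·|jEϖ|^b ≤ r·(|ξ₀|·|cc(α − ρα)|)` in place of `hR : |jEϖ|^b ≤ |ξ₀|·|cc|` (+ `|jEϖ|^b ≤ r`)

Cell `hodgecm-mathlib` (D-0151), FLOOR 0, crux item H413 = `stmt-HodgeConjecture-24833`, route of record `HCCMUnconditional`; squads F0∕P3c∕LH4 + LH7 (hand LH7-p06); lane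
`--supports stmt-HodgeConjecture-24833 --as helper` (count-neutral; pays NO tier-0 row).  THEOREMS ONLY (no `def`, no instance, no notation, no `sorry`, default heartbeats);
★-only imports; states NO law; (β₂) and the RAY-band letters stay HYPOTHESES.
WHY (LH7-p10 (g3) 03:40:10Z, G8 PLAN (ii) «LH7-p06′»).  ★ p864148 §5 `v_coord_sub_coord_le_of_gen` proves `|Vf x₀′ − Vf x₀| ≤ |jEϖ|^b` for two generators of one cell member
from the radius letter `hR : |jEϖ|^b ≤ |ξ₀|·|cc(α − ρα)|` of ★ p863914 — but its proof actually yields the INTRINSIC bound `|κ̂′ − κ̂| ≤ |u₀|²·|cc| = |jEϖ|^{2b}∕|cc|` before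
spending `hR`.  On the DIAGONAL cells of lane C's top line (`j + 1 = b + s0`: `|κ̂| = |κ₀|`, `|ξ₀|·|cc| = |jEϖ|^{b−1}`, ★ G1 `refPair_diag_sizes`) the socket must run at resolution
`b + 1` (radius `|jEϖ|^{b+1} = |jEϖ|^{2b}∕(|ξ₀|·|cc|)`), which `hR`'s shape cannot express.  THIS FILE re-issues §5 and the HEAD §6 with the radius as a PARAMETER:
`{r : ℤᵐ⁰} (hr : Valued.v (jE ϖ) ^ b * Valued.v (jE ϖ) ^ b ≤ r * (Valued.v ξ₀ * Valued.v (jE ϖ ^ j * (α - ρ α))))` in the slot of `hR` (§1; the HEAD takes `(r)`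
explicit in the same slot and drops its old `(r) (hr : |jEϖ|^b ≤ r)` pair; binder ORDER otherwise ★'s — LANEC-RAY-PROGRAM v2 §1 row P6′), conclusions = ★'s with the bound `r`.  ★ §5∕§6 are the instances `r := |jEϖ|^b` (from `hR`: `|jEϖ|^b·|jEϖ|^b ≤ |jEϖ|^b·(|ξ₀|·|cc|)`).
* §1 `v_coord_sub_coord_le_of_gen_of_radius` (digit part, datum-free); §2 HEAD `cls_iff_cls_and_v_sub_le_of_gen_of_radius` (class part ★ `cls_iff_cls_of_gen` BY NAME ∧ §1).
WHAT IS NOT CLAIMED: (hLit), (hF), (hbase), the `hdeep` letter, any count; the class part keeps ★'s hypotheses `d ≤ b ≤ j` (towers and the lane-B diagonal).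
HONEST LABEL.  Count-neutral field ∕ valuation algebra; nothing printed is asserted; no census law is stated; ‹HU_RAY_C♮-diag›, β₂ `stub_law_cleanSgn₂` UNPROVED; `HC_CM` is
proved only modulo the 7 printed citations (2 remaining named inputs: hLiu418 = `stmt-HodgeConjecture-24832`, h413 = `stmt-HodgeConjecture-24833`) until rung 0 closes.
## References
* [Serre1979] J.-P. Serre, *Local Fields*, GTM 67 (1979): Ch. III §6 Prop. 12 (orders `𝒪_E + c𝒪_M`), Ch. V §3 Prop. 5 & Cor. 2–3 (norms near 1).
* [Jacobowitz1962] R. Jacobowitz, *Hermitian forms over local fields*, Amer. J. Math. 84 (1962): §4 (dual lattices, gluing).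
* [Kottwitz1986BaseChangeUnits] R. E. Kottwitz, *Base change for unit elements of Hecke algebras*, Compositio Math. 60 (1986): §1 pp. 240–241 (fixed-lattice counts).
-/

set_option autoImplicit false

noncomputable section

namespace Summit.HodgeConjecture.HodgeConjecture.Cruxes.H413.F0P3cDyRamRowCellGeneratorIndependenceRadius

open scoped Valued WithZero
open WithZero
open Literature.NumberTheory.Automorphic.UnitaryThreeFourFrame (IsRamifiedQuadraticDatum)
open Summit.HodgeConjecture.HodgeConjecture.Cruxes.H413.F0P3cDyRamToricCensusDefs
open Summit.HodgeConjecture.HodgeConjecture.Cruxes.H413.F0P3cDyRamDiagonalCellGeneratorChange (exists_isOrd_mul_of_presentations)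
open Summit.HodgeConjecture.HodgeConjecture.Cruxes.H413.F0P3cDyRamDiagonalCellGeneratorIndependence (v_eq_one_of_isOrd_of_mul_eq_one)
open Summit.HodgeConjecture.HodgeConjecture.Cruxes.H413.F0P3cDyRamRowVertexCoordinateChange (v_normTheta_sub_map_le)
open Summit.HodgeConjecture.HodgeConjecture.Cruxes.H413.F0P3cDyRamRowCellFibreTransport (trace_letters)
open Summit.HodgeConjecture.HodgeConjecture.Cruxes.H413.F0P3cDyRamRowCellGeneratorIndependence (normTheta_gen_mul digit_mul_sub_digit cls_iff_cls_of_gen)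

variable {E M : Type} [Field E] [Valued E ℤᵐ⁰] [Field M] [Valued M ℤᵐ⁰] {ρ Θ : M →+* M} {α : M}

/-! ## §1 THE DIGIT PART at an arbitrary radius -/
omit [Valued E ℤᵐ⁰] in
/-- **(hI), DIGIT PART AT RADIUS `r` — «THE COORDINATE OF `κ̂` MOVES BY AT MOST `r` WHENEVER `|jEϖ|^{2b} ≤ r·|ξ₀|·|cc(α − ρα)|`.**  ★ `v_coord_sub_coord_le_of_gen`'s frame
(only `ρ(jEϖ) = jEϖ`-type letters through `hjfix`, `jEϖ ≠ 0`, `|jEϖ| ≤ 1`, the cell `(j, b)` with `1 ≤ b`, `cc(α − ρα) ≠ 0`, `hFgap`, the pair `κ₀`, `ξ₀ ≠ 0`) with ★'s radius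
letter `hR : |jEϖ|^b ≤ |ξ₀|·|cc|` REPLACED (same position) by `{r : ℤᵐ⁰} (hr : |jEϖ|^b·|jEϖ|^b ≤ r·(|ξ₀|·|cc(α − ρα)|))` and the conclusion's bound `|jEϖ|^b` by `r`.  THEN for two generators
`x₀, x₀′` of one `Λ` with the five `GEN` clauses: `|Vf x₀′ − Vf x₀| ≤ r`.  Proof = ★'s: `|κ̂′ − κ̂| = |u₀|²·|zΘz − ρ(zΘz)| ≤ |u₀|²·|cc(α − ρα)|` and `|u₀|·|cc| = |jEϖ|^b`, so
`|κ̂′ − κ̂|·|cc| ≤ |jEϖ|^{2b} ≤ r·|ξ₀|·|cc|`.  ★ §5 is the case `r := |jEϖ|^b` (its `hR` ⇒ `hr`); on lane C's DIAGONAL cells (`|ξ₀|·|cc| = |jEϖ|^{b−1}`, ★ G1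
`refPair_diag_sizes`) the intrinsic radius `r := |jEϖ|^{b+1}` is admissible. [cite: Serre1979, Ch. III §6 Prop. 12] [cite: Jacobowitz1962, §4] [cite: Kottwitz1986BaseChangeUnits, §1 pp. 240–241] -/
theorem v_coord_sub_coord_le_of_gen_of_radius
    (jE : E →+* M) (hjfix : ∀ z, ρ z = z ↔ ∃ c, jE c = z) {ϖ : E} (hjϖ0 : jE ϖ ≠ 0) (hjϖ1 : Valued.v (jE ϖ) ≤ 1)
    (hρρ : ∀ x, ρ (ρ x) = x) (hvρ : ∀ x, Valued.v (ρ x) = Valued.v x) (hΘΘ : ∀ x, Θ (Θ x) = x) (hΘρ : ∀ x, Θ (ρ x) = ρ (Θ x))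
    (hvΘ : ∀ x, Valued.v (Θ x) = Valued.v x)
    {hM : M} (hΘh : Θ hM = hM) {j b : ℕ} (hb1 : 1 ≤ b) (hcc : jE ϖ ^ j * (α - ρ α) ≠ 0)
    (hFgap : ∀ z : M, ρ z = z → Θ z = z → Valued.v (jE ϖ) < Valued.v z → Valued.v z ≤ 1 → Valued.v z = 1)
    (κ₀ : M) {ξ₀ : M} (hξ0 : ξ₀ ≠ 0)
    {r : ℤᵐ⁰} (hr : Valued.v (jE ϖ) ^ b * Valued.v (jE ϖ) ^ b ≤ r * (Valued.v ξ₀ * Valued.v (jE ϖ ^ j * (α - ρ α))))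
    (Λ : AddSubgroup M) (x₀ x₀' : M)
    (hG : x₀ ≠ 0 ∧ (∀ x, x ∈ Λ ↔ ∃ ζ, IsOrd ρ α (jE ϖ ^ j) ζ ∧ x = x₀ * ζ) ∧
      IsOrd ρ α (jE ϖ ^ j) (dualGen ρ Θ α (jE ϖ ^ j) hM x₀) ∧ ¬ IsOrd ρ α (jE ϖ ^ j) (dualGen ρ Θ α (jE ϖ ^ j) hM x₀ / jE ϖ) ∧
      Valued.v (dualGen ρ Θ α (jE ϖ ^ j) hM x₀) = Valued.v (jE ϖ) ^ b)
    (hG' : x₀' ≠ 0 ∧ (∀ x, x ∈ Λ ↔ ∃ ζ, IsOrd ρ α (jE ϖ ^ j) ζ ∧ x = x₀' * ζ) ∧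
      IsOrd ρ α (jE ϖ ^ j) (dualGen ρ Θ α (jE ϖ ^ j) hM x₀') ∧ ¬ IsOrd ρ α (jE ϖ ^ j) (dualGen ρ Θ α (jE ϖ ^ j) hM x₀' / jE ϖ) ∧
      Valued.v (dualGen ρ Θ α (jE ϖ ^ j) hM x₀') = Valued.v (jE ϖ) ^ b) :
    Valued.v ((ρ (hM * (x₀' * Θ x₀')) / (hM * (x₀' * Θ x₀') + ρ (hM * (x₀' * Θ x₀'))) - κ₀) / ξ₀ -
        (ρ (hM * (x₀ * Θ x₀)) / (hM * (x₀ * Θ x₀) + ρ (hM * (x₀ * Θ x₀))) - κ₀) / ξ₀) ≤ r := by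
  have hρj : ∀ c : E, ρ (jE c) = jE c := fun c => (hjfix _).2 ⟨c, rfl⟩
  have hccAv : (0 : ℤᵐ⁰) < Valued.v (jE ϖ ^ j * (α - ρ α)) := zero_lt_iff.2 ((Valuation.ne_zero_iff _).2 hcc)
  have hξv : (0 : ℤᵐ⁰) < Valued.v ξ₀ := zero_lt_iff.2 ((Valuation.ne_zero_iff _).2 hξ0)
  obtain ⟨hx₀, hΛ, hyO, hyprim, hylev⟩ := hG
  obtain ⟨hx₀', hΛ', hyO', hyprim', hylev'⟩ := hG'
  obtain ⟨-, -, ht1⟩ := trace_letters (α := α) hρρ hΘΘ hΘρ hΘh (hρj ϖ) hjϖ0 hjϖ1 hb1 hcc hFgap hyO hyprim hylev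
  obtain ⟨-, -, ht'1⟩ := trace_letters (α := α) hρρ hΘΘ hΘρ hΘh (hρj ϖ) hjϖ0 hjϖ1 hb1 hcc hFgap hyO' hyprim' hylev'
  have hu₀v : Valued.v (hM * (x₀ * Θ x₀)) * Valued.v (jE ϖ ^ j * (α - ρ α)) = Valued.v (jE ϖ) ^ b := by
    rw [← Valuation.map_mul, ← dualGen_def, hylev]
  -- `x₀′ = x₀·z`, `u₀′ = u₀·N`, `N = zΘz`
  obtain ⟨z, z', hz, hz', hx₀z, hzz'⟩ := exists_isOrd_mul_of_presentations hx₀ hΛ hΛ'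
  have hz1 : Valued.v z = 1 := v_eq_one_of_isOrd_of_mul_eq_one hz hz' hzz'
  have hu₀' : hM * (x₀' * Θ x₀') = hM * (x₀ * Θ x₀) * (z * Θ z) := by rw [hx₀z, normTheta_gen_mul]
  rw [hu₀'] at ht'1 ⊢
  set u₀ : M := hM * (x₀ * Θ x₀) with hu₀def
  set N : M := z * Θ z with hNdef
  have ht0 : u₀ + ρ u₀ ≠ 0 := fun h0 => by rw [h0, map_zero] at ht1; exact zero_ne_one ht1
  have ht'0 : u₀ * N + ρ (u₀ * N) ≠ 0 := fun h0 => by rw [h0, map_zero] at ht'1; exact zero_ne_one ht'1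
  -- the exact change of the digit and its size
  have e0 : (ρ (u₀ * N) / (u₀ * N + ρ (u₀ * N)) - κ₀) / ξ₀ - (ρ u₀ / (u₀ + ρ u₀) - κ₀) / ξ₀ =
      (ρ (u₀ * N) / (u₀ * N + ρ (u₀ * N)) - ρ u₀ / (u₀ + ρ u₀)) / ξ₀ := by ring
  rw [e0, digit_mul_sub_digit hρρ ht0 ht'0, map_div₀, div_le_iff₀ hξv]
  simp only [map_div₀, Valuation.map_mul, hvρ, ht1, ht'1, mul_one, div_one]
  have hskew : Valued.v (ρ N - N) ≤ Valued.v (jE ϖ ^ j * (α - ρ α)) := by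
    rw [← Valuation.map_neg, neg_sub, hNdef]
    exact (v_normTheta_sub_map_le hvρ hΘρ hvΘ z).trans (by rw [hz1, mul_one]; exact hz.2)
  -- the radius letter: `|u₀|²·|cc| ≤ r·|ξ₀|` (cancel one `|cc|` in `|u₀|²·|cc|² = |jEϖ|^{2b} ≤ r·|ξ₀|·|cc|`)
  have hkey : Valued.v u₀ * Valued.v u₀ * Valued.v (jE ϖ ^ j * (α - ρ α)) ≤ r * Valued.v ξ₀ := by
    refine le_of_mul_le_mul_right ?_ hccAv
    calc Valued.v u₀ * Valued.v u₀ * Valued.v (jE ϖ ^ j * (α - ρ α)) * Valued.v (jE ϖ ^ j * (α - ρ α))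
        = Valued.v (jE ϖ) ^ b * Valued.v (jE ϖ) ^ b := by rw [← hu₀v]; ac_rfl
      _ ≤ r * (Valued.v ξ₀ * Valued.v (jE ϖ ^ j * (α - ρ α))) := hr
      _ = r * Valued.v ξ₀ * Valued.v (jE ϖ ^ j * (α - ρ α)) := (mul_assoc _ _ _).symm
  calc Valued.v u₀ * Valued.v u₀ * Valued.v (ρ N - N) ≤ Valued.v u₀ * Valued.v u₀ * Valued.v (jE ϖ ^ j * (α - ρ α)) := by gcongr
    _ ≤ r * Valued.v ξ₀ := hkey

/-! ## §2 HEAD — the (hI) letter at an arbitrary radius -/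
/-- **HEAD — THE (hI) LETTER OF ★ `…ConeCellCountSocketThree.cellDiff_eq_zero_of_fibration_reads₃` AT ★ p863914's `CLS ∕ Vf`, RADIUS `r` WITH `|jEϖ|^{2b} ≤ r·|ξ₀|·|cc|`.**
★ `cls_iff_cls_and_v_sub_le_of_gen`'s frame (datum, `hjv`, class letters `hdb : d ≤ b`, `hbj : b ≤ j`, `hdeep` at `|jEϖ|^{2d}`) with its two radius letters `hR`, `hr : |jEϖ|^b ≤ r`
REPLACED by `(r : ℤᵐ⁰) (hr : |jEϖ|^b·|jEϖ|^b ≤ r·(|ξ₀|·|cc(α − ρα)|))` in `hR`'s position.  THEN for all `Λ x₀ x₀′` with the five `GEN` clauses at `x₀` and at `x₀′`: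
`(CLS x₀ ↔ CLS x₀′) ∧ |Vf x₀′ − Vf x₀| ≤ r` (class part = ★ `cls_iff_cls_of_gen` BY NAME; digit part = §1).
[cite: Serre1979, Ch. III §6 Prop. 12; Ch. V §3 Cor. 3] [cite: Kottwitz1986BaseChangeUnits, §1 pp. 240–241] [cite: Jacobowitz1962, §4] -/
theorem cls_iff_cls_and_v_sub_le_of_gen_of_radius {σ : E →+* E} {ϖ : E} {d tE : ℕ} (hD : IsRamifiedQuadraticDatum σ ϖ d tE)
    (jE : E →+* M) (hjv : ∀ c, Valued.v (jE c) ≤ 1 ↔ Valued.v c ≤ 1) (hjfix : ∀ z, ρ z = z ↔ ∃ c, jE c = z) (hΘj : ∀ c, Θ (jE c) = jE (σ c))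
    (hρρ : ∀ x, ρ (ρ x) = x) (hvρ : ∀ x, Valued.v (ρ x) = Valued.v x) (hΘΘ : ∀ x, Θ (Θ x) = x) (hΘρ : ∀ x, Θ (ρ x) = ρ (Θ x))
    (hvΘ : ∀ x, Valued.v (Θ x) = Valued.v x)
    (hα : ρ α ≠ α) (hα1 : Valued.v α ≤ 1) (hint : ∀ z : M, Valued.v z ≤ 1 → Valued.v ((z - ρ z) / (α - ρ α)) ≤ 1)
    {hM : M} (hΘh : Θ hM = hM) {j b : ℕ} (hb1 : 1 ≤ b) (hdb : d ≤ b) (hbj : b ≤ j) (hcc : jE ϖ ^ j * (α - ρ α) ≠ 0)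
    (hFgap : ∀ z : M, ρ z = z → Θ z = z → Valued.v (jE ϖ) < Valued.v z → Valued.v z ≤ 1 → Valued.v z = 1)
    (hdeep : ∀ u : M, ρ u = u → Θ u = u → Valued.v (u - 1) ≤ Valued.v (jE ϖ) ^ (2 * d) → ∃ c : M, ρ c = c ∧ c * Θ c = u)
    (κ₀ : M) {ξ₀ : M} (hξ0 : ξ₀ ≠ 0)
    (r : ℤᵐ⁰) (hr : Valued.v (jE ϖ) ^ b * Valued.v (jE ϖ) ^ b ≤ r * (Valued.v ξ₀ * Valued.v (jE ϖ ^ j * (α - ρ α))))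
    (Λ : AddSubgroup M) (x₀ x₀' : M)
    (hG : x₀ ≠ 0 ∧ (∀ x, x ∈ Λ ↔ ∃ ζ, IsOrd ρ α (jE ϖ ^ j) ζ ∧ x = x₀ * ζ) ∧
      IsOrd ρ α (jE ϖ ^ j) (dualGen ρ Θ α (jE ϖ ^ j) hM x₀) ∧ ¬ IsOrd ρ α (jE ϖ ^ j) (dualGen ρ Θ α (jE ϖ ^ j) hM x₀ / jE ϖ) ∧
      Valued.v (dualGen ρ Θ α (jE ϖ ^ j) hM x₀) = Valued.v (jE ϖ) ^ b)
    (hG' : x₀' ≠ 0 ∧ (∀ x, x ∈ Λ ↔ ∃ ζ, IsOrd ρ α (jE ϖ ^ j) ζ ∧ x = x₀' * ζ) ∧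
      IsOrd ρ α (jE ϖ ^ j) (dualGen ρ Θ α (jE ϖ ^ j) hM x₀') ∧ ¬ IsOrd ρ α (jE ϖ ^ j) (dualGen ρ Θ α (jE ϖ ^ j) hM x₀' / jE ϖ) ∧
      Valued.v (dualGen ρ Θ α (jE ϖ ^ j) hM x₀') = Valued.v (jE ϖ) ^ b) :
    ((∃ e : M, ρ e = e ∧ e * Θ e = hM * (x₀ * Θ x₀) + ρ (hM * (x₀ * Θ x₀))) ↔
        (∃ e : M, ρ e = e ∧ e * Θ e = hM * (x₀' * Θ x₀') + ρ (hM * (x₀' * Θ x₀')))) ∧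
      Valued.v ((ρ (hM * (x₀' * Θ x₀')) / (hM * (x₀' * Θ x₀') + ρ (hM * (x₀' * Θ x₀'))) - κ₀) / ξ₀ -
        (ρ (hM * (x₀ * Θ x₀)) / (hM * (x₀ * Θ x₀) + ρ (hM * (x₀ * Θ x₀))) - κ₀) / ξ₀) ≤ r := by
  have hϖ : Valued.v ϖ = exp (-1 : ℤ) := hD.2.2.1
  have hvϖ0 : Valued.v ϖ ≠ 0 := by rw [hϖ]; exact exp_ne_zero
  have hϖ0 : ϖ ≠ 0 := fun h0 => by rw [h0, map_zero] at hvϖ0; exact hvϖ0 rfl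
  have hϖ1 : Valued.v ϖ ≤ 1 := by rw [hϖ, ← exp_zero, exp_le_exp]; norm_num
  have hjϖ0 : jE ϖ ≠ 0 := (map_ne_zero jE).2 hϖ0
  have hjϖ1 : Valued.v (jE ϖ) ≤ 1 := (hjv ϖ).2 hϖ1
  exact ⟨cls_iff_cls_of_gen hD jE hjv hjfix hΘj hρρ hvρ hΘΘ hΘρ hvΘ hα hα1 hint hΘh hb1 hdb hbj hcc hFgap hdeep Λ x₀ x₀' hG hG',
    v_coord_sub_coord_le_of_gen_of_radius jE hjfix hjϖ0 hjϖ1 hρρ hvρ hΘΘ hΘρ hvΘ hΘh hb1 hcc hFgap κ₀ hξ0 hr Λ x₀ x₀' hG hG'⟩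

end Summit.HodgeConjecture.HodgeConjecture.Cruxes.H413.F0P3cDyRamRowCellGeneratorIndependenceRadius

end
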